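import Summits.HubbardSuperconductivity.HubbardSuperconductivity.Theses.IsoperimetricCascade
import HarnessLib

/-!
# Crux `IsoperimetricInequality` (stmt-HubbardSuperconductivity-11980; route `IsoperimetricCascade`,
rank 2) — BIRTH SKELETON `Lines/birth.lean` (BC3)

THE CRUX (fixed; `Theses/IsoperimetricCascade.lean`, decl `IsoperimetricInequality`, not restated here):
there is `(U, δ) ∈ [2,8] × [1/10, 2/5]` such that for every spectator number `r` and every `ε > 0`,
for all large even `L`, every normalised `(2K, S^z = 0)`-sector ground state `ψ` of
`hubbardTorus 2 L 1 U` has `μ_n(ψ) ≤ (1+ε)^n μ_1(ψ)^n`, `n = K - r`, `K = ⌊(1-δ)L²/2⌋`,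
`μ_k(ψ) = ‖Δ^k ψ‖² = re ⟨Δ^k ψ, Δ^k ψ⟩`, `Δ = pairField dWaveFormFactor L` — the parameter-free
isoperimetric inequality of pairing (card `isoperimetric-pair-cascade`, K1): the geometric mean of
the pair-emission intensities `I_k = μ_{k+1}/μ_k` along the depletion cascade is at most
`(1+ε) I_0`.

THE LINE = the route's own foreseen glued split of this crux (route header, TWO-LAYER PLAN:
"IsoperimetricInequality ⇐ CascadeNonSuperradiant (card K1′) → MaclaurinEndpoint-instance →
IsoperimetricInequality (k = 2)"), cut at its one natural joint — PHYSICS (the shape of the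
cascade of an unknown repulsive ground state) versus CONVEX GEOMETRY (Newton–Maclaurin /
Minkowski's first inequality for a quasi-log-concave sequence, here for MATRIX cascades):

1. `stub_cascadeQuasiLogConcave` — THE BET (card K1′ `CascadeQuasiLogConcaveAt`, "no Dicke
   superradiance of the ground state's own d-wave pair emission, step by step"): at some
   `(U, δ)` of the window, for every `r` and every budget `ε > 0`, for all large even `L`, the
   depletion cascade of EVERY normalised sector ground state is quasi-log-concave with per-step
   defect `e^{ε/n}`: `μ_k μ_{k+2} ≤ e^{ε/n} μ_{k+1}²` for `k + 2 ≤ n` — equivalently (where the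
   `μ_k` are positive) the intensity never grows by more than `e^{ε/n}` per emitted pair,
   `I_{k+1} ≤ e^{ε/n} I_k`, total growth along the whole cascade `≤ e^ε` (Dicke: the free Fermi sea
   is the INVERTED pseudospin state, `I_k = (K-k)(k+1)` doubles at the first step — superradiance
   — and the stub fails there, as it must; the flat AGP and SU(2)-flat strands below half filling
   of the pair modes, `K/M' = (1-δ)/2 < 1/2`, have non-increasing intensities). Strictly STRONGER
   than the crux (its structural parent: a sup/monotonicity statement where the crux is an
   average). Why it might fail: the card's mean-field calibration (kit j001876) finds a fraction
   0.1–0.2 of small CONVEX (growing) steps, each ≤ 0.024 at `L = 12`, for gaps `2Δ₀ ≲ 0.4t` at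
   `δ ≤ 0.3`; if their total does not vanish as `L → ∞` the step form is false where the endpoint
   form (the crux, `2Δ₀ ≳ 0.1t`) still holds — early bunching `I_1 > (1+η) I_0` compensated later is
   invisible to the crux but fatal here. This stub is the bet of the line, not a lemma; size:
   crux-sized / open.
2. `stub_maclaurinForCascades` — THE ENGINE, for cascades of an arbitrary square complex matrix
   `Δ` applied to a unit vector `ψ` (theorem-grade, S/M): if `μ_k μ_{k+2} ≤ e^c μ_{k+1}²` for all
   `k + 2 ≤ n` (`c ≥ 0`, `μ_k := re ⟨Δ^k ψ, Δ^k ψ⟩`), then `μ_n ≤ e^{c n(n-1)/2} μ_1^n`. It is the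
   landed support `MaclaurinEndpoint` (`Theorems.maclaurinEndpoint_proof`, positive sequences with
   `μ_0 = 1`) PLUS the matrix bookkeeping the route item leaves out: `μ_0 = ‖ψ‖² = 1`
   (`pow_zero`, `one_mulVec`), `μ_1` is `Δ *ᵥ ψ` (`pow_one`), `μ_k ≥ 0`
   (`dotProduct_star_self_nonneg`), and the ZERO TAIL — if some `μ_j = 0` with `j ≤ n` then
   `Δ^j ψ = 0` (`dotProduct_star_self_eq_zero`), hence `Δ^n ψ = Δ^{n-j} (Δ^j ψ) = 0`
   (`pow_add` / `mulVec_mulVec`) and `μ_n = 0 ≤ rhs`; otherwise all `μ_k > 0` and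
   `maclaurinEndpoint_proof` applies verbatim. Why a stub and not inlined: it is the reusable matrix
   form of the engine (with a constant `c` it also turns K1′-with-a-constant into the `∃C` cascade
   criterion of the target `IsoCascade`), provable now from landed lemmas.

COMPOSITION `IsoperimetricInequality_of` (no `sorry`; hypotheses = the two stub statements under
their registered names `__Registered.stub_*`, conclusion = the route decl BY NAME): take stub 1's
witness `(U, δ)`; given `r, ε > 0` run stub 1 with the budget `ε' := log (1+ε) > 0`; for `L ≥ L₀`
even and a normalised sector ground state `ψ`, stub 2 at `ι := Finset (Orb (FermionTorus 2 L))`,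
`Δ := pairField dWaveFormFactor L`, `c := log(1+ε)/n ≥ 0` gives
`μ_n ≤ e^{(log(1+ε)/n)·n(n-1)/2} μ_1^n = (1+ε)^{(n-1)/2} μ_1^n ≤ (1+ε)^n μ_1^n`
(`exp_budget_le_pow`, using `μ_1 ≥ 0`). About 25 lines of real analysis + logic, axioms
`propext / Classical.choice / Quot.sound`; `IsoperimetricInequality_skeleton` is the same proof
with the two sorried stubs plugged in (the crux by name modulo exactly the registered stubs).

DISPROOF USED: no `Cruxes/IsoperimetricInequality/Disproof.lean` exists (2026-08-17; `ledger crux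
ls`: no workfiles); `ledger negatives --problem HubbardSuperconductivity` (2 entries: CooperPairDMottWalk
breathing self-duality, AposterioriCapRg KLS-order openness) — unrelated to cascades; no landed
`Theorems/IsoperimetricInequality/Negative/*`. Refuter evidence on the item (CruxAttack-11980.md,
Scratch.lean): degenerate ends `n = 0, 1` close TRUE, triviality tactics fail on the crux; the same
holds for stub 1 (its `n ≤ 1` instances are vacuous) — no stub is an instance of a refuted statement.

Sources: A. J. Coleman, J. Math. Phys. 6 (1965) 1425 (extreme AGP); R. J. Gardner, Bull. AMS 39
(2002) 355, doi:10.1090/s0273-0979-02-00941-2 §§5–7 (Minkowski's first / Newton–Maclaurin);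
M. C. Tichy, P. A. Bouvrie, K. Mølmer, Phys. Rev. A 86 (2012) 042317,
doi:10.1103/physreva.86.042317 (composite-boson cascades `χ_N = N! e_N`); R. H. Dicke, Phys. Rev. 93
(1954) 99 (superradiance dictionary). No definition is introduced into the tree: the statements
are inlined in the stubs (so the registered signatures are self-contained; stub 1 is stated `let`-free
because the stub scraper cuts a signature at the first `:=`) and repeated once, as `rfl`-equal
name-keyed aliases, for the skeleton audit. Registered with `ledger skeleton check` 2026-08-17 (v3).
-/

noncomputable section

-- `dupNamespace`: the summit and the problem are both named `HubbardSuperconductivity` (layout D-0022)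
set_option linter.dupNamespace false

namespace Summit.HubbardSuperconductivity.HubbardSuperconductivity.Cruxes.IsoperimetricInequality.Birth

open Matrix
open Literature.MathematicalPhysics.QuantumLattice
open scoped ComplexOrder Matrix

/-! ## Registered stubs (the only `sorry`s of this file) -/

/-- **stub 1 — `stub_cascadeQuasiLogConcave` (K1′, cascade quasi-log-concavity of every ground
state at a witness point; THE BET, hardest stub, open physics).** At some
`(U, δ) ∈ [2,8] × [1/10, 2/5]`: for every spectator number `r` and every budget `ε > 0` there is
`L₀` such that for every even `L ≥ L₀` and every normalised `(2K, S^z = 0)`-sector ground state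
`ψ` of `hubbardTorus 2 L 1 U` (`K = ⌊(1-δ)L²/2⌋`), with `Δ = pairField dWaveFormFactor L`,
`n = K - r` and `μ_k = re ⟨Δ^k ψ, Δ^k ψ⟩`: `μ_k μ_{k+2} ≤ e^{ε/n} μ_{k+1}²` for all `k + 2 ≤ n`
(no superradiant growth of the pair-emission intensity along the cascade, total budget `e^ε`). Stated
`let`-free (the crux's `Δ`, `n` inlined) so that the registered signature is self-contained.
Card `isoperimetric-pair-cascade` K1′; Dicke, Phys. Rev. 93 (1954) 99 (what fails for the Fermi sea). -/
theorem stub_cascadeQuasiLogConcave :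
    ∃ U ∈ Set.Icc (2:ℝ) 8, ∃ δ ∈ Set.Icc (1/10:ℝ) (2/5), ∀ r : ℕ, ∀ ε : ℝ, 0 < ε → ∃ L₀ : ℕ,
      ∀ (L : ℕ) [NeZero L], L₀ ≤ L → Even L →
      ∀ ψ : Fock (Orb (FermionTorus 2 L)), star ψ ⬝ᵥ ψ = 1 →
        IsGroundStateInSector (hubbardTorus 2 L 1 U) (2 * ⌊(1 - δ) * (L : ℝ) ^ 2 / 2⌋₊) 0 ψ →
        ∀ k : ℕ, k + 2 ≤ ⌊(1 - δ) * (L : ℝ) ^ 2 / 2⌋₊ - r →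
          (star (pairField dWaveFormFactor L ^ k *ᵥ ψ) ⬝ᵥ (pairField dWaveFormFactor L ^ k *ᵥ ψ)).re *
              (star (pairField dWaveFormFactor L ^ (k + 2) *ᵥ ψ) ⬝ᵥ
                (pairField dWaveFormFactor L ^ (k + 2) *ᵥ ψ)).re ≤
            Real.exp (ε / ((⌊(1 - δ) * (L : ℝ) ^ 2 / 2⌋₊ - r : ℕ) : ℝ)) *
              (star (pairField dWaveFormFactor L ^ (k + 1) *ᵥ ψ) ⬝ᵥ
                (pairField dWaveFormFactor L ^ (k + 1) *ᵥ ψ)).re ^ 2 := by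
  sorry

/-- **stub 2 — `stub_maclaurinForCascades` (Newton–Maclaurin / Minkowski-first endpoint for
MATRIX cascades; THE ENGINE, provable now).** For every finite index type `ι`, square complex
matrix `Δ`, unit vector `ψ` (`star ψ ⬝ᵥ ψ = 1`), `n` and `c ≥ 0`: if
`μ_k μ_{k+2} ≤ e^c μ_{k+1}²` for all `k + 2 ≤ n` (`μ_k := re ⟨Δ^k ψ, Δ^k ψ⟩`), then
`μ_n ≤ e^{c n(n-1)/2} μ_1^n` (`μ_1` written with `Δ *ᵥ ψ`). = the landed `MaclaurinEndpoint`
(`Theorems.maclaurinEndpoint_proof`) + `μ_0 = 1`, `μ_k ≥ 0` and the zero tail `μ_j = 0 ⇒ μ_n = 0`.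
Gardner, Bull. AMS 39 (2002) 355 §§5–7; Tichy–Bouvrie–Mølmer, Phys. Rev. A 86 (2012) 042317. -/
theorem stub_maclaurinForCascades :
    ∀ (ι : Type) [Fintype ι] [DecidableEq ι] (Δ : Matrix ι ι ℂ) (ψ : ι → ℂ) (n : ℕ) (c : ℝ),
      0 ≤ c → star ψ ⬝ᵥ ψ = 1 →
      (∀ k : ℕ, k + 2 ≤ n →
        (star (Δ ^ k *ᵥ ψ) ⬝ᵥ (Δ ^ k *ᵥ ψ)).re *
            (star (Δ ^ (k + 2) *ᵥ ψ) ⬝ᵥ (Δ ^ (k + 2) *ᵥ ψ)).re ≤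
          Real.exp c * (star (Δ ^ (k + 1) *ᵥ ψ) ⬝ᵥ (Δ ^ (k + 1) *ᵥ ψ)).re ^ 2) →
      (star (Δ ^ n *ᵥ ψ) ⬝ᵥ (Δ ^ n *ᵥ ψ)).re ≤
        Real.exp (c * ((n : ℝ) * ((n : ℝ) - 1) / 2)) * (star (Δ *ᵥ ψ) ⬝ᵥ (Δ *ᵥ ψ)).re ^ n := by
  sorry

/-! ## Name-keyed aliases of the stub statements — the hypotheses of `IsoperimetricInequality_of`

The native skeleton audit (`#h21_check_skeleton`) admits a hypothesis of the skeleton theorem only if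
its head constant is a registered obligation or is NAMED like a declared stub; `__Registered.stub_X`
is the statement of `stub_X` under that name (device of `Cruxes/OverlapNondegeneracy/Lines/birth.lean`
and `Cruxes/AmplitudeLDP/Lines/birth.lean` of AtomisticToContinuum). Each alias is `rfl`-equal to the
type of its stub — certified below by `IsoperimetricInequality_skeleton`, which feeds the stubs
themselves to `IsoperimetricInequality_of`. -/
namespace __Registered

/-- The statement of `stub_cascadeQuasiLogConcave`, keyed by the registered stub name. -/
abbrev stub_cascadeQuasiLogConcave : Prop :=
  ∃ U ∈ Set.Icc (2:ℝ) 8, ∃ δ ∈ Set.Icc (1/10:ℝ) (2/5), ∀ r : ℕ, ∀ ε : ℝ, 0 < ε → ∃ L₀ : ℕ,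
    ∀ (L : ℕ) [NeZero L], L₀ ≤ L → Even L →
    ∀ ψ : Fock (Orb (FermionTorus 2 L)), star ψ ⬝ᵥ ψ = 1 →
      IsGroundStateInSector (hubbardTorus 2 L 1 U) (2 * ⌊(1 - δ) * (L : ℝ) ^ 2 / 2⌋₊) 0 ψ →
      ∀ k : ℕ, k + 2 ≤ ⌊(1 - δ) * (L : ℝ) ^ 2 / 2⌋₊ - r →
        (star (pairField dWaveFormFactor L ^ k *ᵥ ψ) ⬝ᵥ (pairField dWaveFormFactor L ^ k *ᵥ ψ)).re *
            (star (pairField dWaveFormFactor L ^ (k + 2) *ᵥ ψ) ⬝ᵥ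
              (pairField dWaveFormFactor L ^ (k + 2) *ᵥ ψ)).re ≤
          Real.exp (ε / ((⌊(1 - δ) * (L : ℝ) ^ 2 / 2⌋₊ - r : ℕ) : ℝ)) *
            (star (pairField dWaveFormFactor L ^ (k + 1) *ᵥ ψ) ⬝ᵥ
              (pairField dWaveFormFactor L ^ (k + 1) *ᵥ ψ)).re ^ 2

/-- The statement of `stub_maclaurinForCascades`, keyed by the registered stub name. -/
abbrev stub_maclaurinForCascades : Prop :=
  ∀ (ι : Type) [Fintype ι] [DecidableEq ι] (Δ : Matrix ι ι ℂ) (ψ : ι → ℂ) (n : ℕ) (c : ℝ),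
    0 ≤ c → star ψ ⬝ᵥ ψ = 1 →
    (∀ k : ℕ, k + 2 ≤ n →
      (star (Δ ^ k *ᵥ ψ) ⬝ᵥ (Δ ^ k *ᵥ ψ)).re *
          (star (Δ ^ (k + 2) *ᵥ ψ) ⬝ᵥ (Δ ^ (k + 2) *ᵥ ψ)).re ≤
        Real.exp c * (star (Δ ^ (k + 1) *ᵥ ψ) ⬝ᵥ (Δ ^ (k + 1) *ᵥ ψ)).re ^ 2) →
    (star (Δ ^ n *ᵥ ψ) ⬝ᵥ (Δ ^ n *ᵥ ψ)).re ≤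
      Real.exp (c * ((n : ℝ) * ((n : ℝ) - 1) / 2)) * (star (Δ *ᵥ ψ) ⬝ᵥ (Δ *ᵥ ψ)).re ^ n

end __Registered

/-! ## Composition: the crux BY NAME from the two stub statements (no `sorry` below) -/

/-- The budget bookkeeping of the composition: with per-step defect `c = log(1+ε)/n` the
accumulated Maclaurin defect `e^{c n(n-1)/2} = (1+ε)^{(n-1)/2}` is at most `(1+ε)^n`. [folklore] -/
theorem exp_budget_le_pow {ε : ℝ} (hε : 0 < ε) (n : ℕ) :
    Real.exp (Real.log (1 + ε) / n * ((n : ℝ) * ((n : ℝ) - 1) / 2)) ≤ (1 + ε) ^ n := by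
  have h1ε : 0 < 1 + ε := by linarith
  have hlog : 0 ≤ Real.log (1 + ε) := Real.log_nonneg (by linarith)
  have hpow : Real.exp ((n : ℝ) * Real.log (1 + ε)) = (1 + ε) ^ n := by
    rw [← Real.log_pow, Real.exp_log (pow_pos h1ε n)]
  rw [← hpow]
  apply Real.exp_le_exp.2
  rcases Nat.eq_zero_or_pos n with hn | hn
  · subst hn
    simp
  · have hnR : (0 : ℝ) < (n : ℝ) := by exact_mod_cast hn
    have hn0 : (n : ℝ) ≠ 0 := ne_of_gt hnR
    have heq : Real.log (1 + ε) / n * ((n : ℝ) * ((n : ℝ) - 1) / 2) =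
        Real.log (1 + ε) * (((n : ℝ) - 1) / 2) := by
      calc Real.log (1 + ε) / n * ((n : ℝ) * ((n : ℝ) - 1) / 2)
          = Real.log (1 + ε) * (((n : ℝ) - 1) / 2) * ((n : ℝ) / n) := by ring
        _ = Real.log (1 + ε) * (((n : ℝ) - 1) / 2) := by rw [div_self hn0, mul_one]
    rw [heq]
    have h2 : ((n : ℝ) - 1) / 2 ≤ (n : ℝ) := by linarith
    calc Real.log (1 + ε) * (((n : ℝ) - 1) / 2) ≤ Real.log (1 + ε) * (n : ℝ) :=
          mul_le_mul_of_nonneg_left h2 hlog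
      _ = (n : ℝ) * Real.log (1 + ε) := mul_comm _ _

/-- **IsoperimetricInequality_of** — quasi-log-concavity of the ground-state cascade (stub 1) ×
the Maclaurin engine for matrix cascades (stub 2) ⟹ the crux: at stub 1's witness `(U, δ)`, run it
with budget `log(1+ε)`; stub 2 with `c = log(1+ε)/n` gives `μ_n ≤ (1+ε)^{(n-1)/2} μ_1^n ≤ (1+ε)^n μ_1^n`.
Hypotheses = the two stub statements under their registered names; conclusion = the route decl,
by name. -/
theorem IsoperimetricInequality_of (h₁ : __Registered.stub_cascadeQuasiLogConcave)
    (h₂ : __Registered.stub_maclaurinForCascades) :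
    Summit.HubbardSuperconductivity.HubbardSuperconductivity.Theses.IsoperimetricCascade.IsoperimetricInequality := by
  dsimp only [__Registered.stub_cascadeQuasiLogConcave] at h₁
  dsimp only [__Registered.stub_maclaurinForCascades] at h₂
  dsimp only [Summit.HubbardSuperconductivity.HubbardSuperconductivity.Theses.IsoperimetricCascade.IsoperimetricInequality]
  obtain ⟨U, hU, δ, hδ, hcasc⟩ := h₁
  refine ⟨U, hU, δ, hδ, fun r ε hε => ?_⟩
  have hε' : 0 < Real.log (1 + ε) := Real.log_pos (by linarith)
  obtain ⟨L₀, hL⟩ := hcasc r (Real.log (1 + ε)) hε'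
  refine ⟨L₀, fun L _ hL₀ hEven ψ hψ hGS => ?_⟩
  have hdef := hL L hL₀ hEven ψ hψ hGS
  try dsimp only at hdef
  try dsimp only
  -- the engine at `ι := Finset (Orb (FermionTorus 2 L))`, `Δ := pairField dWaveFormFactor L`,
  -- `c := log(1+ε)/n ≥ 0`
  have key := h₂ (Finset (Orb (FermionTorus 2 L))) (pairField dWaveFormFactor L) ψ
    (⌊(1 - δ) * (L : ℝ) ^ 2 / 2⌋₊ - r) (Real.log (1 + ε) / (⌊(1 - δ) * (L : ℝ) ^ 2 / 2⌋₊ - r : ℕ))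
    (div_nonneg hε'.le (Nat.cast_nonneg _)) hψ hdef
  refine key.trans ?_
  -- `μ_1 ≥ 0` and the budget `e^{c n(n-1)/2} ≤ (1+ε)^n`
  have hμ₁ : 0 ≤ (star (pairField dWaveFormFactor L *ᵥ ψ) ⬝ᵥ
      (pairField dWaveFormFactor L *ᵥ ψ)).re :=
    (Complex.nonneg_iff.1 (dotProduct_star_self_nonneg _)).1
  exact mul_le_mul_of_nonneg_right (exp_budget_le_pow hε _) (pow_nonneg hμ₁ _)

/-- **IsoperimetricInequality_skeleton** — the crux BY NAME modulo exactly the two registered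
stubs (A12 form): the composition fed with `stub_cascadeQuasiLogConcave` and
`stub_maclaurinForCascades` themselves; it also certifies that each `__Registered` alias is the
type of its stub. Closed as soon as both stubs land. -/
theorem IsoperimetricInequality_skeleton :
    Summit.HubbardSuperconductivity.HubbardSuperconductivity.Theses.IsoperimetricCascade.IsoperimetricInequality :=
  IsoperimetricInequality_of stub_cascadeQuasiLogConcave stub_maclaurinForCascades

end Summit.HubbardSuperconductivity.HubbardSuperconductivity.Cruxes.IsoperimetricInequality.Birth
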